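import Mathlib
import HarnessLib
import HarnessLib.Audit
import Summits.AtomisticToContinuum.Statement

/-!
Route: BECHardSphereComparison

CLOSED (retired) 2026-08-15T13:38:44Z by operator:999:1257524 — reason: not-a-thesis: assembly does not conclude the sub-problem Statement — note: D-0027 §2.1 audit (human 2026-08-15: routes that do not decide the summit are removed): the assembly concludes `Literature.MathematicalPhysics.QuantumManyBody.BoseGas.BoseEinsteinCondensation`, not the sub-problem statement; a NEW conforming route may be opened from the same idea (generated `closes . The file is kept as the record of this route; refuted decls are indexed as negative knowledge (`ledger negatives`).

X_HS (HARD-SPHERE COMPARISON LINE; idea card repulsion-monotone-hard-sphere, absorbing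
hard-sphere-extremality).
It suffices to show HardCoreDominates ∧ HardSphereBEC:
(i) HardCoreDominates — HARD CORES OF THE SAME RANGE ARE THE WORST CASE, at fixed N and L, once
dilute: for every
measurable radial v ≥ 0 vanishing beyond R > 0 (hence v ≤ HS_R := ⊤·1_{[0,R]} pointwise) there is
η₀(v) > 0 such that
condensateNumber HS_R N L ≤ condensateNumber v N L whenever N·R³ ≤ η₀·L³. Since interaction_v ≡ 0 on
Ω_N(R) = {all pairwise distances > R}, H_{HS_R} is exactly H_v compressed to H¹₀(Ω_N(R)): the claim
is that imposing
the Dirichlet constraint "no pair closer than R" on the ground state can only lower λ_max(γ).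
(ii) HardSphereBEC — the conjunct for the single scale-free family v = HS_a: ∀ a > 0 ∃ ρ₀ > 0 ∀ ρ ∈
(0, ρ₀),
HasGroundStateBEC HS_a ρ (a function of η = ρa³ only by HardSphereScaling); its ground state is the
principal
Dirichlet eigenfunction of −Δ on Ω_{N,L,a} = Λ_L^N minus a dilute union of tubes, and BEC is
delocalisation on
average of its one-particle slices (HardSphereZeroMode).
X_HS → BoseEinsteinCondensation (Assembly, PROVED in the planner's sketch, 25 lines): given v of
range R₀ put
R := max R₀ 1 and ρ₀(v) := min(ρ₀^{HS}(R), η₀(v)/R³); for ρ < ρ₀(v) and every N the guard N R³ ≤ η₀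
N/ρ = η₀ L_N³
holds (L_N = (N/ρ)^{1/3}) and cN ≤ condensateNumber HS_R N L_N ≤ condensateNumber v N L_N.
Lean (rc 0 in Sketch.lean; constants
Literature.MathematicalPhysics.QuantumManyBody.BoseGas.{condensateNumber,
HasGroundStateBEC, BoseEinsteinCondensation}, Set.indicator, Set.Iic; HS_a := Set.indicator (Set.Iic
a) (fun _ => ⊤)):
X := (∀ (v : ℝ → ENNReal) (R : ℝ), Measurable v → 0 < R → (∀ r : ℝ, R < r → v r = 0) → ∃ η₀ : ℝ, 0 <
η₀ ∧
  ∀ (N : ℕ) (L : ℝ), (N : ℝ) * R ^ 3 ≤ η₀ * L ^ 3 →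
  condensateNumber (Set.indicator (Set.Iic R) (fun _ : ℝ => (⊤ : ENNReal))) N L ≤ condensateNumber v
N L)
 ∧ (∀ a : ℝ, 0 < a → ∃ ρ₀ : ℝ, 0 < ρ₀ ∧ ∀ ρ : ℝ, 0 < ρ → ρ < ρ₀ →
  HasGroundStateBEC (Set.indicator (Set.Iic a) (fun _ : ℝ => (⊤ : ENNReal))) ρ)
Assembly := HardCoreDominates → HardSphereBEC →
Literature.MathematicalPhysics.QuantumManyBody.BoseGas.BoseEinsteinCondensation.

Rationale: WHY THIS LINE. The conjunct quantifies over a whole function class (∀ v repulsive finite range) but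
physics says the
condensate depletion is governed, to leading order in every dilute regime, by the scattering length
alone
(few-body in a box: depletion ∝ (a/L)²; GP window; thermodynamic: 1 − n₀/N = (8/3√π)√(ρa³),
Bogoliubov; DMC/PIGS data
GiorginiBoronatCasulleras1999, RossiSalasnich2013), and a(v) ≤ a(HS_R) = R for every v of range R
(scatteringLength_mono = LiebSeiringerSolovejYngvason2005 App. C Lemma C.2). ONE inequality —
HardCoreDominates — turns
"more repulsion, less coherence" into a theorem and collapses the class to the maximally symmetric
case: hard spheres,
a one-parameter (η = ρa³) family with no energy scale, whose ground state is a principal DIRICHLET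
EIGENFUNCTION of the
Laplacian on a tube complement in ℝ^{3N}. Areas imported: (a) correlation/comparison inequalities
(Ginibre1970,
FortuinKasteleynGinibre1971; quantum-XY monotonicity in couplings BenassiLeesUeltschi2016) —
un-normalised objects ARE
ordered (Feynman–Kac: e^{−tH_HS}(X,Y) ≤ e^{−tH_v}(X,Y) pointwise; domain monotonicity of Dirichlet
heat kernels,
Davies1989), the open point is the normalised ratio, exactly the FKG situation; (b) spectral
geometry / probabilistic
potential theory of obstacle complements (taboo process = Brownian motion in Λ^N conditioned to
avoid the tubes,
Donsker–Varadhan; Smoluchowski collision rate 4πρa = O(ξ⁻²)); (c) exact scale invariance of hard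
spheres. No physical
analogy is used beyond the heuristics quoted.
RANKED CRUXES. 2: HardCoreDominates [formal, rc 0] — novel, structurally meaningful (compression to
H¹₀(Ω_N(R))),
cheaply refutable (N = 2, 3 numerics), and the step a structural mechanism would deliver at fixed
(N, L); the dilute
guard N R³ ≤ η₀(v) L³ excludes dense-box pathologies (clustering inside hard shells, jamming) that
are outside the
conjecture anyway. 3: HardSphereBEC [formal, rc 0] — the conjunct at v = HS_a (weaker than the
target by instantiation);
LSSY's open problem for the model case; any method; the card's handle is (b).
SUPPORT (rank 9, unranked for staffing): HardSphereScaling (cn(HS_a,N,L) = cn(HS_1,N,L/a), change of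
variables);
HardSphereBoxMonotone (pure spectral geometry: once dilute, enlarging the box at fixed N never
lowers λ_max(γ) of the
principal eigenfunction — the fixed-ratio instances are cases of crux 2; first target for provers
AND refuters);
HardSphereZeroMode (X_B1 at v = HS_1: constant-mode occupation ≥ cN = average slice delocalisation
E_X[(∫Ψ₀ dz)²/(L³∫Ψ₀² dz)] ≥ c; implies crux 3 with Scaling via bec_of_zeroMode). 1: Assembly
(proved in folder).
KILL CRITERIA. A refutation of HardCoreDominates in the DILUTE regime (some v ≤ HS_R, N R³ ≤ η L³
with η → 0 along the
witnesses, cn(HS_R) > cn(v)) closes the route — and is itself valuable negative knowledge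
(non-monotone functional of
Ψ₀; order reversal = non-universality beyond LHY). Since η₀ is existential, a refutation must beat
every η₀ (e.g. a
fixed pair (v, R) and boxes L_k → ∞ at fixed N, or N_k R³/L_k³ → 0). ¬HardSphereBoxMonotone for
every η₀ kills the
mechanism (domain monotonicity) even if crux 2 survived formally. HardSphereBEC cannot be refuted
without refuting
the conjunct.
NOT DECOMPOSED YET (D-0019). TWO-LAYER PLAN, filed only when a crux closes or a census asks:
HardCoreDominates ⇐
ContinuityAtHardCore (cn(v + t·1_{[0,R]}) → cn(HS_R) as t → ∞: monotone form convergence, compact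
resolvent) →
CovarianceSign (d/dt λ_max(γ_t) = −2∫₀^∞ Cov_s^{(t)}(n̂_top, V_R) ds ≤ 0: positive imaginary-time
correlation between
condensate occupation and core overlap in every ground state along the path) → HardCoreDominates (k
= 2);
HardSphereBEC ⇐ HardSphereZeroMode → HardSphereScaling → HardSphereBEC (glue = bec_of_zeroMode
pattern; both already
filed as support). No Literature definition is requested: HS_a is inline (Set.indicator (Set.Iic a)
⊤, admissible:
IsRepulsiveFiniteRange proved in Sketch), Ω_N and the taboo process are proof devices, not statement
vocabulary.
CHEAPEST FALSIFIER (for refuters; kit not in this planner's budget): N = 2 in a Dirichlet cube, L/R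
∈ {6, 10, 16}
(η = 2R³/L³ ≤ 10⁻²), lattice Laplacian 32³ per particle exploiting cubic symmetry / relative
coordinates, Lanczos
ground state, λ_max(γ) by SVD: (a) t ↦ λ_max for v_t = t·1_{[0,R]}, t ∈ [0, ∞] must be
non-increasing; (b) v = HS_{R/2},
HS_{0.9R}, HS_{R/2} + finite shell on [0.8R, R]: each must give λ_max ≥ λ_max(HS_R) beyond
discretisation error;
(c) box monotonicity L ↦ λ_max(HS_1, N = 2, 3) on L ∈ [4, 20]. Analytic: second-order perturbation
theory for N = 2
with δv a thin shell at radius ≲ R (sign of the cross term).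

Novelty: NOVELTY (searches run BEFORE this claim). Card author (ideate-5/ -9, 2026-08-15): crossref
"monotonicity condensate
fraction interaction strength", "comparison principle one-particle density matrix", "Griffiths
inequalities quantum
XY / Bose", hybrid in LSSY2005/Griffin1993/Pethick–Smith, lit frontier. Novelty audit-12 (refuter,
2026-08-15T10:37Z,
graded NEW-COMBINATION): zbMATH 'condensate fraction monotone scattering length comparison ground
state bosons' 0;
galaxy --star all substring 'condensate fraction is a monotonically decreasing function' 0; galaxy
pdf bm25
'is the condensate fraction monotone decreasing in the repulsive interaction? comparison inequality
between two
potentials for the one-particle density matrix' (12 hits, none relevant: 2D/1D theses, Bose polaron,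
Rougerie EMS
survey). This planner (2026-08-15T11:10–11:30Z): crossref ×4 ("monotonicity condensate fraction
repulsive
interaction Bose gas ground state hard spheres" → found CarlenJauslinLieb2021 =
doi:10.1137/20m1376820, read pp.1–2:
monotonicity/convexity of e(ρ) and a condensate fraction WITHIN Lieb's 1963 simple equation —
different object, no
comparison between potentials; "comparison inequality one-particle density matrix two potentials
bosons" → 1D
impenetrable-boson ODM papers only; "principal Dirichlet eigenfunction hard sphere configuration
space off-diagonal
long-range order" → nothing; "condensate fraction hard-sphere bosons zero temperature path integral"
→
RossiSalasnich2013 = arXiv:1309.732  [refs: 10.1137/20m1376820, 10.1103/physreva.60.5129, 1309.7326, 2603.20776, 2510.20493, 2602.16566, doi:10.1137/20m1376820, book:lieb2005, doi:10.1103/physreva.60.5129, LSSY2005, Griffin1993, CarlenJauslinLieb2021, RossiSalasnich2013, Davies1989, Junge2026, ChongLiangNam2026, GiorginiBoronatCasulleras1999, PenroseOnsager1956, LiebSeiringerSolovejYngvason2005, Ginibre1970, FortuinKasteleynGinibre1971, Ben]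

Barriers (technique_class: correlation-inequality domain-monotonicity hard-spheres): technique_class: correlation-inequality domain-monotonicity hard-spheres
(catalogue Literature/Barriers/AtomisticToContinuum read 2026-08-15: OneDimensionalHardCore,
PitaevskiiStringariOneDimension,
KineticGapLengthScales, EnergyAsymptoticsWithoutCondensation, BogoliubovPerturbationInfrared,
FeynmanCyclesVersusCondensation,
CasimirBoxGeneralizedCondensation, SymmetryBreakingWithoutCondensate, SutoDegenerateGroundStates;
negatives index: 0 refuted.)
- Literature.Barriers.AtomisticToContinuum.KineticGapLengthScales: APPLIES squarely to HardSphereBEC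
/ HardSphereZeroMode —
  every condensation proof in hand controls depletion by (box side)² × (energy excess) and stops at
L ≲ a(ρa³)^{-3/4-η}
  (Fournais2020 Thm 1.2, Junge2026 Cor. 6); Harnack chains / heat-kernel mixing of the principal
eigenfunction across
  distance L re-import the L² gap. NOT evaded; the bet: RATIOS of conditional slices of Ψ₀ need only
the dilute
  renewal (collision) time ξ² of the taboo process, not the mixing time L². HardCoreDominates is
OUTSIDE the class:
  it compares two states at the same (N, L) and uses no gap, no localisation, no energy.
- Literature.Barriers.AtomisticToContinuum.EnergyAsymptoticsWithoutCondensation: EVADED by design —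
no item consumes
  energy asymptotics; crux 2 compares STATES of two Hamiltonians whose energies differ already at
leading order
  (4πρ a(v) vs 4πρR), crux 3 is about an eigenfunction's shape.
- Literature.Barriers.AtomisticToContinuum.OneDimensionalHardCore and .Pita

Novelty grade: new-combination — ROUTE REVIEW (refuter g2, 2026-08-15; completes unit 5ec9aa5a: g0 did KarpPeierls + WeilCone). Route CLOSED 13:38Z (D-0027 §2.1: Assembly ends in Literature…BoseEinsteinCondensation, not _root_). 6/6 decls rc0 (W.lean, my folder); conformance = one token: `hA h1 h2 : _root_.BoseEinsteinCondensation` (refuter refuter-rreview-route-AtomisticToContinu-5ec9aa5a-g2-0, 2026-08-15T14:05:48Z; prior: LSSY2005 App.C Lemma C.2; Davies1989 Ch.2; Ginibre1970/FKG1971; CarlenJauslinLieb2021 doi:10.1137/20m1376820; Baym-Blaizot-Holzmann-Laloe-Vautherin PRL83(1999)1703 + Kashurnikov-Prokofev-Svistunov PRL87(2001)120402 + Seiringer-Ueltschi PRB80(2009)014502 (T_c shift counter-analogy))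

History (route lifecycle, newest last):
- 2026-08-15T13:38:44Z · CLOSED retired — not-a-thesis: assembly does not conclude the sub-problem Statement (operator:999:1257524)

sub-problem: BoseEinsteinCondensation · status: closed(retired) · opened planner-plancard-AtomisticToContinuum-BoseEin-516cf05c-0 2026-08-15T11:17:51Z · rev 0 · ledger route-AtomisticToContinuum-BECHardSphereComparison
GENERATED by the gate from the ledger (D-0016/17). Provers cite these decls: `theorem foo : Summit.AtomisticToContinuum.BoseEinsteinCondensation.Theses.BECHardSphereComparison.<Decl> := …` in Summits/AtomisticToContinuum/BoseEinsteinCondensation/Theorems/<Name>.lean.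
-/

namespace Summit.AtomisticToContinuum.BoseEinsteinCondensation.Theses.BECHardSphereComparison

open scoped BigOperators Topology Manifold Classical MeasureTheory ProbabilityTheory Matrix InnerProductSpace ComplexConjugate ContinuousMap
open Filter Set Function TopologicalSpace MeasureTheory

attribute [summit_statement] _root_.BoseEinsteinCondensation

/-- item stmt-AtomisticToContinuum-3438 · crux · rank 2 · closed · moot by None · by planner
why it might fail: dλ_max/dt under v+tδv is −2∫₀^∞Cov_s(n̂_top,δV)ds (ground-state imaginary-time covariance): no sign a priori at interacting v — only UN-normalised kernels are domain-monotone; Bogoliubov heuristic Σ_k ∂_g n(ε_k,ρv̂_k)ρδv̂_k has negative summands for shell-like δv; beyond-LHY terms decide if a(v)≈R.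
sources: GiorginiBoronatCasulleras1999, RossiSalasnich2013, LiebSeiringerSolovejYngvason2005 App. C Lemma C.2 (= Literature.MathematicalPhysics.QuantumManyBody.BoseGas.scatteringLength_mono), Ginibre1970, FortuinKasteleynGinibre1971, BenassiLeesUeltschi2016
[crux] HARD CORES OF THE SAME RANGE ARE THE WORST CASE (fixed N, L; dilute). For every measurable
radial v ≥ 0 vanishing beyond R > 0 (so v ≤ HS_R := ⊤·1_{[0,R]} = Set.indicator (Set.Iic R) ⊤
pointwise) there is η₀(v) > 0 such that for all N, L with N·R³ ≤ η₀·L³: condensateNumber HS_R N L ≤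
condensateNumber v N L. Since interaction_v ≡ 0 on Ω_N(R) = {all pairwise distances > R}
(interaction_eq_zero_of_lt_dist), H_{HS_R} is H_v compressed to H¹₀(Ω_N(R)): imposing the Dirichlet
constraint 'no pair closer than R' on the ground state can only lower λ_max(γ). Leading-order
heuristics agree in every dilute regime (few-body box: depletion ∝ (a/L)²; GP window; thermodynamic:
(8/3√π)√(ρa³)) because a(v) ≤ a(HS_R) = R (scatteringLength_mono, LSSY App. C Lemma C.2), and
DMC/PIGS data for hard vs soft spheres are consistent (GiorginiBoronatCasulleras1999;
RossiSalasnich2013) — but no order-by-order argument is a proof: the bet is a STRUCTURAL comparison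
(Feynman–Kac kernel domination e^{-tH_HS}(X,Y) ≤ e^{-tH_v}(X,Y) pointwise = domain monotonicity of
Dirichlet heat kernels, Davies1989; Ginibre1970/FKG-type control of the normalised ratio γ/Z). Edge
cases harmless: N ≤ 1 equality; E₀(HS_R) = ⊤ -/
@[route_item "route-AtomisticToContinuum-BECHardSphereComparison"]
def HardCoreDominates : Prop :=
  ∀ (v : ℝ → ENNReal) (R : ℝ), Measurable v → 0 < R → (∀ r : ℝ, R < r → v r = 0) → ∃ η₀ : ℝ, 0 < η₀ ∧ ∀ (N : ℕ) (L : ℝ), (N : ℝ) * R ^ 3 ≤ η₀ * L ^ 3 → Literature.MathematicalPhysics.QuantumManyBody.BoseGas.condensateNumber (Set.indicator (Set.Iic R) (fun _ : ℝ => (⊤ : ENNReal))) N L ≤ Literature.MathematicalPhysics.QuantumManyBody.BoseGas.condensateNumber v N L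

/-- item stmt-AtomisticToContinuum-3439 · crux · rank 3 · closed · moot by None · by planner
why it might fail: LSSY's open problem for the model case: every condensation proof in hand pays the kinetic gap L² and stops at L ≲ a(ρa³)^{-3/4-η} (Fournais2020 Thm 1.2, Junge2026 Cor 6); Harnack/heat-kernel control of Ψ₀ across distance L re-imports it; hard cores are worst for v̂-based Bogoliubov machinery.
sources: LiebSeiringerSolovejYngvason2005 Ch. 5 (5.2) and p. 42; Ch. 2 (hard spheres, Dyson lemma), Dyson1957, Fournais2020, FournaisSolovej2020, Junge2026, Basti2022
[crux] DILUTE HARD-SPHERE BEC: for every diameter a > 0 there is ρ₀(a) > 0 with HasGroundStateBEC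
(⊤·1_{[0,a]}) ρ for 0 < ρ < ρ₀ — the conjunct restricted to the one-parameter, scale-free
hard-sphere family (weaker than the target by instantiation; by HardSphereScaling a statement about
η = ρa³ only). Finite energy forces Ψ = 0 on {dist(x_i,x_j) ≤ a}, so the ground state is the
principal Dirichlet eigenfunction Ψ₀ of −Δ on Ω_{N,L,a} = {X ∈ Λ_L^N : |x_i − x_j| > a}, the
complement of a DILUTE union of tubes in ℝ^{3N}; BEC ⟸ HardSphereZeroMode (one-particle slices z ↦
Ψ₀(z,X) delocalised on average). Proposed handles (card): taboo-process / Donsker–Varadhan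
representation of Ψ₀ (Brownian motion in Λ^N conditioned to avoid the tubes; a tagged coordinate
meets a tube at Smoluchowski rate 4πρa = O(ξ⁻²), so ratios of slices should need the collision time
ξ² rather than the mixing time L²), domain monotonicity, exact scale invariance;
hard-sphere-specific energy technology: Dyson1957, Basti2022, FournaisSolovej2020. Any method closes
it; d = 3 must enter (false in d = 1: OneDimensionalHardCore). -/
@[route_item "route-AtomisticToContinuum-BECHardSphereComparison"]
def HardSphereBEC : Prop :=
  ∀ a : ℝ, 0 < a → ∃ ρ₀ : ℝ, 0 < ρ₀ ∧ ∀ ρ : ℝ, 0 < ρ → ρ < ρ₀ → Literature.MathematicalPhysics.QuantumManyBody.BoseGas.HasGroundStateBEC (Set.indicator (Set.Iic a) (fun _ : ℝ => (⊤ : ENNReal))) ρ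

/-- item stmt-AtomisticToContinuum-3440 · support · rank 9 · closed · moot by None · by planner
sources: LiebSeiringerSolovejYngvason2005 Ch. 2
[support] EXACT SCALE COVARIANCE: condensateNumber (HS a) N L = condensateNumber (HS 1) N (L/a) for
a > 0. The dilation X ↦ aX maps TrialState N (L/a) onto TrialState N L (ψ ↦ a^{-3N/2} ψ(·/a)),
multiplies energy by a⁻² (kinetic: chain rule; interaction: 1_{dist ≤ a}(aX) = 1_{dist ≤ 1}(X),
⊤·|ψ|² matches), so E₀ scales by a⁻² and the near-minimiser sets correspond (δ ↔ a²δ), while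
maxOccupation is dilation invariant (modes dilate with L²-norm preserved). Consequence used
downstream: HasGroundStateBEC (HS a) ρ ↔ HasGroundStateBEC (HS 1) (ρa³) because sideLength ρ N / a =
sideLength (ρa³) N. Routine but real Lean (lintegral change of variables on Fin N → EuclideanSpace ℝ
(Fin 3): Measure.map of X ↦ a • X, addHaar_smul; fderiv of ψ ∘ (a⁻¹ • ·)). Sources:
LiebSeiringerSolovejYngvason2005 Ch. 2 (2.1)–(2.2) (dimensionless parameter ρa³). -/
@[route_item "route-AtomisticToContinuum-BECHardSphereComparison"]
def HardSphereScaling : Prop :=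
  ∀ (a L : ℝ) (N : ℕ), 0 < a → Literature.MathematicalPhysics.QuantumManyBody.BoseGas.condensateNumber (Set.indicator (Set.Iic a) (fun _ : ℝ => (⊤ : ENNReal))) N L = Literature.MathematicalPhysics.QuantumManyBody.BoseGas.condensateNumber (Set.indicator (Set.Iic 1) (fun _ : ℝ => (⊤ : ENNReal))) N (L / a)

/-- item stmt-AtomisticToContinuum-3441 · support · rank 9 · closed · moot by None · by planner
sources: RossiSalasnich2013, GiorginiBoronatCasulleras1999, Davies1989
[support] PURE SPECTRAL-GEOMETRY SPECIAL CASE — 'diluting hard spheres never lowers the condensate':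
there is η₀ > 0 such that for all N and L₁ ≤ L₂ with N ≤ η₀ L₁³, condensateNumber (HS 1) N L₁ ≤
condensateNumber (HS 1) N L₂, i.e. once dilute, L ↦ λ_max(γ) of the principal Dirichlet
eigenfunction of Ω_{N,L,1} is non-decreasing at fixed N. Via HardSphereScaling equivalent to 'a ≤ b
⇒ cn(HS_b, N, L) ≤ cn(HS_a, N, L) under N b³ ≤ η₀ L³', whose instances at FIXED ratio a/b are the
cases v := HS_a, R := b of HardCoreDominates (uniformity of η₀ in the ratio is the only extra
content). Evidence at large N (periodic): the PIGS fit n₀/n = Ξ(na³) = 1 − (8/3√π)√x − 5.49x +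
7.86x^{3/2} + 9.52x² − 13.65x^{5/2} of RossiSalasnich2013 (p. 6) is strictly decreasing on the whole
fluid branch x = na³ < 0.278 (checked); GiorginiBoronatCasulleras1999. First target for
domain-monotonicity provers and for N = 2, 3 refuters (L ↦ λ_max(HS_1, N, L), L ∈ [4, 20]). Why it
might fail: the same covariance-sign issue as HardCoreDominates; at N = 2 both boxes' depletions are
O((1/L)²) and monotone only at leading order. -/
@[route_item "route-AtomisticToContinuum-BECHardSphereComparison"]
def HardSphereBoxMonotone : Prop :=
  ∃ η₀ : ℝ, 0 < η₀ ∧ ∀ (N : ℕ) (L₁ L₂ : ℝ), (N : ℝ) ≤ η₀ * L₁ ^ 3 → L₁ ≤ L₂ → Literature.MathematicalPhysics.QuantumManyBody.BoseGas.condensateNumber (Set.indicator (Set.Iic 1) (fun _ : ℝ => (⊤ : ENNReal))) N L₁ ≤ Literature.MathematicalPhysics.QuantumManyBody.BoseGas.condensateNumber (Set.indicator (Set.Iic 1) (fun _ : ℝ => (⊤ : ENNReal))) N L₂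

/-- item stmt-AtomisticToContinuum-3442 · support · rank 9 · closed · moot by None · by planner
sources: LiebSeiringerSolovejYngvason2005 §1.2 (1.17)–(1.19), Fournais2020, Literature.Barriers.AtomisticToContinuum.KineticGapLengthScales, Literature.Barriers.AtomisticToContinuum.FeynmanCyclesVersusCondensation
[support] SLICE DELOCALISATION (the card's reformulation (ii), typed) — the constant-mode form of
HardSphereBEC at unit diameter: ∃ η₁ > 0 ∀ η ∈ (0, η₁) ∃ c > 0, for all large N ∃ δ > 0, every
δ-near-minimiser Ψ of the unit-hard-sphere energy in the Dirichlet box L = (N/η)^{1/3} has ⟨φ₀, γ_Ψ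
φ₀⟩ ≥ cN, φ₀ = L^{-3/2}1_{Λ_L} (encoding identical to X_B1 = BECInfraredBound's bec_zero_mode_thesis
at v = HS_1, hence implied by it). For Ψ ≥ 0: ⟨φ₀, γ_Ψ φ₀⟩/N = E_X[(∫Ψ(z,X)dz)²/(L³∫Ψ(z,X)²dz)], X ~
the (N−1)-body marginal — the average delocalisation ratio (∈ [0,1], = 1 iff the slice is constant)
of the conditional one-particle slices of the principal eigenfunction, the functional the
taboo-process picture addresses (renewal at collision rate 4πρa vs mixing L²). Implies HardSphereBEC
together with HardSphereScaling by occupation_le_maxOccupation + le_condensateNumber (pattern: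
theorem bec_of_zeroMode, Theorems/BECInfraredBoundAssembly.lean). Expected constant c → 1 − O(√η)
(GP boundary layer of width ξ = (8πη)^{-1/2} ≪ L; free gas would give only (8/π²)³ ≈ 0.53). Why it
might fail: as HardSphereBEC (KineticGapLengthScales not evaded), plus the mode commitment to the
constant in a Dirichlet -/
@[route_item "route-AtomisticToContinuum-BECHardSphereComparison"]
def HardSphereZeroMode : Prop :=
  ∃ η₁ : ℝ, 0 < η₁ ∧ ∀ η : ℝ, 0 < η → η < η₁ → ∃ c : ℝ, 0 < c ∧ ∀ᶠ N : ℕ in Filter.atTop, ∃ δ : ENNReal, 0 < δ ∧ ∀ Ψ : Literature.MathematicalPhysics.QuantumManyBody.BoseGas.TrialState N (Literature.MathematicalPhysics.QuantumManyBody.BoseGas.sideLength η N), Literature.MathematicalPhysics.QuantumManyBody.BoseGas.energy (Set.indicator (Set.Iic 1) (fun _ : ℝ => (⊤ : ENNReal))) Ψ ≤ Literature.MathematicalPhysics.QuantumManyBody.BoseGas.groundStateEnergy (Set.indicator (Set.Iic 1) (fun _ : ℝ => (⊤ : ENNReal))) N (Literature.MathematicalPhysics.QuantumManyBody.BoseGas.sideLength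 η N) + δ → ENNReal.ofReal (c * N) ≤ Literature.MathematicalPhysics.QuantumManyBody.BoseGas.occupation N ((Literature.MathematicalPhysics.QuantumManyBody.BoseGas.box (Literature.MathematicalPhysics.QuantumManyBody.BoseGas.sideLength η N)).indicator fun _ => ((Real.sqrt (Literature.MathematicalPhysics.QuantumManyBody.BoseGas.sideLength η N ^ 3))⁻¹ : ℂ)) Ψ.ψ

/-- item stmt-AtomisticToContinuum-3443 · assembly · rank 1 · closed · moot by None · by planner
[assembly] HardCoreDominates → HardSphereBEC → BoseEinsteinCondensation. Proof (DONE in the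
planner's folder, AssemblyProbe.lean rc 0, ~25 lines, attached as evidence): given v with
IsRepulsiveFiniteRange v = ⟨hmeas, R₀, hR₀⟩ put R := max R₀ 1 (0 < R, v r = 0 for r > R); get η₀
from HardCoreDominates v R and ρ₁ from HardSphereBEC R; take ρ₀ := min ρ₁ (η₀/R³); for 0 < ρ < ρ₀
the BEC constant c of HS_R at ρ works for v: eventually ofReal(cN) ≤ cn(HS_R) N L_N ≤ cn(v) N L_N,
the guard N R³ ≤ η₀ L_N³ following from L_N³ = N/ρ (sideLength, Real.rpow_mul) and ρR³ ≤ η₀. -/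
@[route_item "route-AtomisticToContinuum-BECHardSphereComparison"]
def Assembly : Prop :=
  HardCoreDominates → HardSphereBEC → Literature.MathematicalPhysics.QuantumManyBody.BoseGas.BoseEinsteinCondensation

end Summit.AtomisticToContinuum.BoseEinsteinCondensation.Theses.BECHardSphereComparison
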